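import Literature.MathematicalPhysics.QuantumFieldTheory.Balaban1983to89.B9Eq326DeltaAEtaScalingZdPer

/-!
# `Balaban1983to89.B9Thm33BindersUniformZdPerNestedEta` — [Balaban1985BackgroundPropagators] Thm 3.11 p. 416 ∕ Thm 3.3 (3.42)–(3.47) p. 397–398 for the GENUINE periodic record
# at the nested periodic members of [Balaban1985RegularSpaces]'s class: (§1) the both-points Hölder binder (3.45) from the gradient entry of (3.47) at ANY nested member;
# (§2) ★ THE N05 WITNESS SLOT's FIVE N06 BINDERS WITH ONE CONSTANT SET FOR ALL MEMBERS `j : IdxB8SubDPerκ θ P Mκ Rκ` AND ALL TRUNCATIONS AT A FIXED PERIOD — WITH NO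
# `η`-LAW: dag-n06-b g25's `IdxB8SubDPerκ.binders_uniform_of_eta_law` (p682259) with its hypothesis `hηk` DISCHARGED by the `η`-scaling family of `B9Eq326DeltaAEtaScalingZdPer`

statement-level skeleton of published theorems with citation tags; proofs where landed; nothing here is a claim about the Yang–Mills mass gap

`[Balaban1985BackgroundPropagators]` ("B9", CMP **99** (1985) 389–434): Thm 3.11 p. 416, Thm 3.3 p. 399, (3.40) p. 397, (3.42) p. 397, (3.43)–(3.47) p. 398, (3.26)–(3.27) p. 395.
`[Balaban1985RegularSpaces]` ("B8", CMP **99**): (1.3)–(1.6) p. 77, p. 77 *«T_η, η = L^{−k}»*, *«Ω_j ⊂ T_η»*, (1.31) p. 82, (1.39) p. 82, (1.58)–(1.59) p. 86, Thm 8 + (1.146) p. 101,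
p. 83 *«Let us rescale the expressions from T_η to T₁»*.  PDF held: `paper:balaban1985-cmp99-background-propagators` pp. 395–399, 416 (re-read by this seat, 2026-08-29).

CITATION HEADER (lean-in-tree rule).  Cell `pub-ymgap` (YM Track A), DAG node N06 = [B9], seat `pub-ymgap-dag-n06-b` (g26), the (β′-PERIODIC) road.  WHY: the N05 witness slot of
record (dag-n05-c's door ζ-L p673108, `…N05SubBP2DK2PerKappaSlotExistsOfBindersLettersPerDoorL`) and dag-n24-c's K1-face door display N06's five binder families
`hinv ∕ hglob ∕ hhol ∕ hsrc ∕ hsrcH` over ALL members `a : IdxB8SubDPerκ θ P Mκ Rκ` with the constants `aI aT aS B₀ᴺ C_β c_S c_Sβ` OUTSIDE `∀ a`.  g25's FILE F supplied exactly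
this shape GIVEN an `η`-law `∀ j, j.η = ηfun j.k` (referee ref-A g37 READ-40: «CONDITIONAL-CLOSED … booking without the law is a SMUGGLE»; dag-n05-d g22: road (ii)(b) = a
director's `η`-cut of the index, road (i) = the `η`-scaling).  THIS FILE IS ROAD (i): the law is not needed — two members with the same code `(k, (Ω_l on the torus)_{l ≤ P})`
agree on `(k, Ω, Λs m↾≤m)` by rigidity and differ only in the spacing and in unread junk, and by `B9Eq326DeltaAEtaScalingZdPer` the (3.27) binder and the (3.47) block of one
transfer to the other WITH THE SAME CONSTANTS; the Hölder binder (3.45) (whose admissible-pair set moves with `η`) and the two source binders are then DERIVED at the target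
member from its transferred (3.47) block (§1 here; g25's `srcAtIPer_of_globAtIPer_of_zero` ∕ `srcHolderAtIH2Per_of_holderAtIH2Per_of_zero`).  Consumers: the door's
`hinv…hsrcH` by `obtain` + dag-n05-d's two glue lines (`a_S := a_T`; `C_β ↦ max C_β 1` by `holderAtIH2Per_anti`) — NO `η` hypothesis, NO director word needed.

WHAT IS PROVED (kernel, 0 sorry; theorems only — no `def`, no `instance`, no `notation`).
* §1 ★★ `holderAtIH2Per_of_globAtIPer` — at ANY member (`2 ≤ d`, `1 ≤ L`, integer lengths, a record whose Green's function is periodic at periodic data):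
  `GlobAtIPer P L ops aT B₀ M i m ⟹ HolderAtIH2Per P L ops aT (2B₀(Lᵐ)^β) β len M i m` for every `0 ≤ β` (dag-n06-b g24's `holderAtIPer_of_globAtIPer_of_len` needed «Ω_j = ℤᵈ»
  for the first-point edition; in the both-points edition both gradient values are bonds touching `Ω_j`).
* §2 ★★★★★★ `IdxB8SubDPerκ.binders_uniform` — `2 ≤ D`, `0 ≤ β`, integer lengths ⟹ `∃ aI aT > 0, B₀ > 0, C_β c_S c_Sβ ≥ 0, ∀ j : IdxB8SubDPerκ θ P Mκ Rκ, ∀ m ≤ k,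
  InvAtHIPer … aI ∧ GlobAtIPer … aT B₀ ∧ HolderAtIH2Per … aT C_β β len ∧ SrcAtIPer … aT c_S ∧ SrcHolderAtIH2Per … aT c_Sβ β len` for
  `opsAllZdPer τ θ.L P (fun k l => towerBondsP θ.L j.toZdIdx.Ω (j.toZdIdx.Λs k) l) ops₀ … M j.toZdIdx m` — g25's statement VERBATIM minus `(ηfun) (hηk)`.  Constants:
  `aI, aT` = `inf'`, `B₀` = `sup'` over the finite code type of the representatives' per-member constants (g25 FILE E `IdxB8SubDPerκ.binders_opsAllZdPer_allLevels`),
  `C_β = 2B₀(Lᴾ)^β`, `c_S = B₀·2K(Lᴾ)³`, `c_Sβ = 2B₀(Lᴾ)^β·2K(Lᴾ)³`, `K = max{1, |[0,P)ᵈ|·C_τ∕κ}`.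

HONEST SCOPE.  (i) The constants are per PERIOD `P` (and `τ`, `M`, `β`, `len`): volume-uniformity in `P` (print's Thm 3.3 ∕ 3.11 «uniformly in U, Ω_j», dag-n16's `P_k = N·Lᵏ`
ladder) is NOT proved — it is [B9] Sects. B–C (localisation + random walk), the coercivity ∕ random-walk lanes' content.  (ii) The per-code constants still come from
compactness (g24∕g25), not from print's `M₀, α₀′`.  (iii) Count-neutral; N06 NOT discharged; K1⁹ NOT closed; counts UNMOVED; one finite `𝕋⁴` programme at fixed `ε`, Bałaban
as printed; nothing continuum ∕ ℝ⁴ ∕ OS ∕ mass gap ∕ Clay.  Unit `pub-ymgap-dag-n06-b` (g26), 2026-08-29; NEW file importing this seat's `B9Eq326DeltaAEtaScalingZdPer`; modifies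
nothing.  Net new unproved facts: 0.
-/

noncomputable section

namespace Literature.MathematicalPhysics.QuantumFieldTheory.Balaban1983to89.B9Thm33BindersUniformZdPerNestedEta

open B7Prop1Explicit B7Prop2Explicit
open B7Prop1Local (InBox loK bondHiK)
open B8Ineq132 (covDerivFwd InAk plaqF BondTouches)
open B8Eq140Level (SideTouches sideTouches_of_bondTouches)
open B8ScaledSupNorm (weight msup Bdd bondNorm)
open B8Eq138LandauZd (covLap covDivB QT)
open B8LeafModelZd (ZdIdx)
open B9SupplySockB9P3ZdLetters (OpsZd deltaAOf)
open B9Eq327GreenZdHermPer (domSubHPer RegularAtHPer InvAtHIPer gopZdHPer withGopZdHPer)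
open B9SupplySockB9P3ZdPer (GlobAtIPer)
open B9SupplySockB9P3ZdH2Per (HolderAtIH2Per)
open B9SupplySockB9P3ZdAllLettersZdPer (opsAllZdPer opsLandauPer)
open B9SupplySockB9P3ZdSrcPer (SrcAtIPer SrcHolderAtIH2Per)
open B9Eq340HolderZd (hquot AdmPair hquot_nonneg)
open B8TowerBondsPrinted (towerBondsP)
open B9Thm33GlobalBlockWitnessCubeZd (exists_norm_sq_le_re_trace)
open B9Thm33SourceWitnessZdPerNested (srcAtIPer_of_globAtIPer_of_zero srcHolderAtIH2Per_of_holderAtIH2Per_of_zero)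
open B9Eq326DeltaAEtaScalingZdPer (invAtHIPer_of_eta_mul globAtIPer_of_eta_mul)
open Node00 (Stage3Params IdxB8SubD IdxB8SubDPer IdxB8SubDPerκ)
open T4TermwiseTorus (IsPeriodic box tcls tlift)

-- `Site` alone could resolve to the torus sites of `Setup.lean`; re-export the `ℤ^d` sites of `B7Prop1Explicit`.
export B7Prop1Explicit (Site)

variable {d : ℕ} {𝔸 : Type*} [CStarAlgebra 𝔸]

/-! ## §1  The Hölder binder (3.45), both-points edition, from the gradient entry of (3.47) — at ANY nested member -/

section Holder

variable [Nontrivial 𝔸] (P L : ℕ) [NeZero P]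

/-- ★★ **ON THE TORUS, THE BOTH-POINTS HÖLDER BINDER (3.45) AT ANY EXPONENT `0 ≤ β` FOLLOWS FROM THE GRADIENT ENTRY OF (3.47) AT EVERY NESTED MEMBER** — `2 ≤ d`,
`1 ≤ L`, integer lengths (`len v ≥ 1` whenever `len v > 0`), a record whose Green's function is periodic at periodic data: `GlobAtIPer P L ops aT B₀ M i m ⟹
HolderAtIH2Per P L ops aT (2B₀(Lᵐ)^β) β len M i m`.  Both points of an admissible pair lie in `Ω_j`, so BOTH gradient values are bonds touching `Ω_j` and are read by
(3.47)'s entry `n = 1` (dag-n06-b g24's `holderAtIPer_of_globAtIPer_of_len` needed «Ω_j = ℤᵈ» for the first-point edition; the both-points edition needs nothing):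
`|R(U₀(Γ))F(x′) − F(x)|∕(η·len)^β ≤ (‖F x′‖ + ‖F x‖)·η^{−β}` and `(Lʲη)^{2+β} ≤ (Lʲη)²·(Lᵐη)^β`.
[cite: Balaban1985BackgroundPropagators, (3.45), (3.47) p.398, (3.40) p.397, Thm 3.3 p.399; Balaban1985RegularSpaces, (1.59) p.86, (1.39) p.82, p.77 («Ω_j ⊂ T_η»)] -/
theorem holderAtIH2Per_of_globAtIPer (hd2 : 2 ≤ d) (hL : 1 ≤ L)
    {ops : ℝ → ZdIdx d L → ℕ → OpsZd d 𝔸} {aT B₀ M : ℝ} {i : ZdIdx d L} {m : ℕ} (hB₀ : 0 ≤ B₀)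
    (hGper : ∀ (U₀ : Site d → Fin d → 𝔸ˣ) (J : Site d → Fin d → 𝔸), IsPeriodic P U₀ → J ∈ domSubHPer (d := d) (𝔸 := 𝔸) P →
      IsPeriodic P ((ops M i m).Gop U₀ J))
    {β : ℝ} (hβ : 0 ≤ β) {len : Site d → ℝ} (hlen : ∀ v : Site d, 0 < len v → 1 ≤ len v) (h : GlobAtIPer P L ops aT B₀ M i m) :
    HolderAtIH2Per P L ops aT (2 * B₀ * (((L : ℝ) ^ m) ^ β)) β len M i m := by
  intro α₀ U₀ hU₀ hper hα hαT hIn J hJ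
  obtain ⟨-, h1, -⟩ := h α₀ U₀ hU₀ hper hα hαT hIn J hJ
  obtain ⟨G, hG⟩ : ∃ G, (ops M i m).Gop U₀ J = G := ⟨_, rfl⟩
  rw [hG] at h1
  rw [hG]
  obtain ⟨F, hF⟩ : ∃ F : Fin d × Fin d × Site d → 𝔸, (fun t => covDerivFwd i.η U₀ t.1 (fun z => G z t.2.1) t.2.2) = F := ⟨_, rfl⟩
  rw [hF] at h1
  obtain ⟨NJ, hNJ⟩ : ∃ NJ, bondNorm L m i.η (-(3 : ℝ)) i.Ω J = NJ := ⟨_, rfl⟩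
  rw [hNJ] at h1
  rw [hNJ]
  have hη := i.hη
  have hNJ0 : 0 ≤ NJ := by rw [← hNJ]; exact B8ScaledSupNorm.msup_nonneg L m hη.le _ _ _
  have hU1 : ∀ y κ, U₀ y κ ∈ U1 𝔸 := fun y κ => unitaryUnits_le_U1 (hU₀ y κ)
  -- the gradient family is periodic, hence bounded, hence its weighted members are below its weighted supremum
  have hGp : IsPeriodic P G := by rw [← hG]; exact hGper U₀ J hper hJ
  have hFval : ∀ t, F t = covDerivFwd i.η U₀ t.1 (fun z => G z t.2.1) t.2.2 := fun t => by rw [← hF]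
  have hFper : ∀ ν κ : Fin d, IsPeriodic P fun x => F (ν, κ, x) := fun ν κ => by
    have : (fun x => F (ν, κ, x)) = covDerivFwd i.η U₀ ν (fun z => G z κ) := funext fun x => hFval (ν, κ, x)
    rw [this]
    exact B9Eq327GreenZdHermPer.isPeriodic_covDerivFwd i.η hper ν (B9Eq327GreenZdHermPer.isPeriodic_apply_dir hGp κ)
  have hbd : ∀ t, ‖F t‖ ≤ ∑ ν : Fin d, ∑ κ : Fin d, ∑ ξ : Fin d → ZMod P, ‖F (ν, κ, tlift ξ)‖ := by
    rintro ⟨ν, κ, x⟩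
    calc ‖F (ν, κ, x)‖ ≤ ∑ ξ : Fin d → ZMod P, ‖F (ν, κ, tlift ξ)‖ := B9B8KnitHolderZeroOfGlob.norm_le_sum_box_of_isPeriodic (hFper ν κ) x
      _ ≤ ∑ κ' : Fin d, ∑ ξ : Fin d → ZMod P, ‖F (ν, κ', tlift ξ)‖ :=
          Finset.single_le_sum (f := fun κ' : Fin d => ∑ ξ : Fin d → ZMod P, ‖F (ν, κ', tlift ξ)‖)
            (fun _ _ => Finset.sum_nonneg fun _ _ => norm_nonneg _) (Finset.mem_univ κ)
      _ ≤ ∑ ν' : Fin d, ∑ κ' : Fin d, ∑ ξ : Fin d → ZMod P, ‖F (ν', κ', tlift ξ)‖ :=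
          Finset.single_le_sum (f := fun ν' : Fin d => ∑ κ' : Fin d, ∑ ξ : Fin d → ZMod P, ‖F (ν', κ', tlift ξ)‖)
            (fun _ _ => Finset.sum_nonneg fun _ _ => Finset.sum_nonneg fun _ _ => norm_nonneg _) (Finset.mem_univ ν)
  set c := ∑ ν : Fin d, ∑ κ : Fin d, ∑ ξ : Fin d → ZMod P, ‖F (ν, κ, tlift ξ)‖ with hc
  have hLr : (1 : ℝ) ≤ L := by exact_mod_cast hL
  have hBdd : Bdd L m i.η (-(2 : ℝ)) (fun j (t : Fin d × Fin d × Site d) => SideTouches (i.Ω j) t.2.2 t.2.1) F := by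
    have e2 : (-(2 : ℝ)) = -((2 : ℕ) : ℝ) := by norm_num
    rw [e2]
    refine B8ScaledSupNorm.bdd_of_forall (c := ((L : ℝ) ^ m * i.η) ^ 2 * c) fun j hj t _ => ?_
    rw [B8ScaledSupNorm.weight_neg_natCast]
    have hw : ((L : ℝ) ^ j * i.η) ^ 2 ≤ ((L : ℝ) ^ m * i.η) ^ 2 :=
      pow_le_pow_left₀ (by positivity) (mul_le_mul_of_nonneg_right (pow_le_pow_right₀ hLr hj) hη.le) 2
    exact mul_le_mul hw (hbd t) (norm_nonneg _) (by positivity)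
  -- a second direction exists (`d ≥ 2`), so a bond at a site of `Ω_j` is a side of a plaquette touching `Ω_j`
  have hdir : ∀ κ : Fin d, ∃ κ' : Fin d, κ' ≠ κ := fun κ => by
    by_cases h0 : (κ : ℕ) = 0
    · exact ⟨⟨1, by omega⟩, fun hk => by have := congrArg Fin.val hk; simp at this; omega⟩
    · exact ⟨⟨0, by omega⟩, fun hk => by have := congrArg Fin.val hk; simp at this; omega⟩
  have hmem : ∀ (j : ℕ) (x : Site d) (κ : Fin d), x ∈ i.Ω j → SideTouches (i.Ω j) x κ := fun j x κ hx => by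
    obtain ⟨κ', hκ'⟩ := hdir κ
    exact sideTouches_of_bondTouches hκ' (Or.inl hx)
  have hpt : ∀ j, j ≤ m → ∀ (ν κ : Fin d) (x : Site d), x ∈ i.Ω j → weight L i.η (-(2 : ℝ)) j * ‖F (ν, κ, x)‖ ≤ B₀ * NJ :=
    fun j hj ν κ x hx => (B8ScaledSupNorm.weight_mul_norm_le_msup hBdd hj (i := (ν, κ, x)) (hmem j x κ hx)).trans h1
  -- the Hölder supremum at exponent `β`
  have hLm0 : (0 : ℝ) ≤ (L : ℝ) ^ m := by positivity
  have hCβ0 : 0 ≤ 2 * B₀ * (((L : ℝ) ^ m) ^ β) := by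
    have : 0 ≤ ((L : ℝ) ^ m) ^ β := Real.rpow_nonneg hLm0 β
    positivity
  refine B8ScaledSupNorm.msup_le (by positivity) fun j hj q hq => ?_
  obtain ⟨ν, κ, x, x'⟩ := q
  obtain ⟨hadm, hx, hx'⟩ := hq
  have hq0 : 0 ≤ hquot i.η β len U₀ (covDerivFwd i.η U₀ ν fun z => G z κ) (x, x') := hquot_nonneg hη.le β U₀ _ hadm
  rw [Real.norm_of_nonneg hq0]
  -- the weight: `(Lʲη)^{2+β} = (Lʲη)²·(Lʲη)^β ≤ (Lʲη)²·(Lᵐη)^β`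
  have hs0 : 0 < (L : ℝ) ^ j * i.η := by positivity
  have hsm : (L : ℝ) ^ j * i.η ≤ (L : ℝ) ^ m * i.η := mul_le_mul_of_nonneg_right (pow_le_pow_right₀ hLr hj) hη.le
  have hwsplit : weight L i.η (-(2 + β)) j = weight L i.η (-(2 : ℝ)) j * ((L : ℝ) ^ j * i.η) ^ β := by
    simp only [weight, neg_neg]
    rw [Real.rpow_add hs0, Real.rpow_two]
  have hwβ : ((L : ℝ) ^ j * i.η) ^ β ≤ ((L : ℝ) ^ m * i.η) ^ β := Real.rpow_le_rpow hs0.le hsm hβ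
  -- the quotient: `≤ (‖F x′‖ + ‖F x‖)·η^{−β}`
  have hηβ : 0 < i.η ^ β := Real.rpow_pos_of_pos hη β
  have hden : i.η ^ β ≤ (i.η * len ((x, x').2 - (x, x').1)) ^ β := by
    apply Real.rpow_le_rpow hη.le _ hβ
    have := hlen _ hadm.1
    nlinarith
  have hnum : ‖B9Eq340HolderZd.trans U₀ (x, x').1 (x, x').2 ((covDerivFwd i.η U₀ ν fun z => G z κ) (x, x').2) -
      (covDerivFwd i.η U₀ ν fun z => G z κ) (x, x').1‖ ≤ ‖F (ν, κ, x')‖ + ‖F (ν, κ, x)‖ := by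
    calc _ ≤ ‖B9Eq340HolderZd.trans U₀ (x, x').1 (x, x').2 ((covDerivFwd i.η U₀ ν fun z => G z κ) (x, x').2)‖ +
          ‖(covDerivFwd i.η U₀ ν fun z => G z κ) (x, x').1‖ := norm_sub_le _ _
      _ = ‖F (ν, κ, x')‖ + ‖F (ν, κ, x)‖ := by rw [B9Eq340HolderZd.norm_trans hU1, hFval (ν, κ, x'), hFval (ν, κ, x)]
  have hquo : hquot i.η β len U₀ (covDerivFwd i.η U₀ ν fun z => G z κ) (x, x') ≤ (‖F (ν, κ, x')‖ + ‖F (ν, κ, x)‖) * (i.η ^ β)⁻¹ := by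
    rw [B9Eq340HolderZd.hquot_def, div_eq_mul_inv]
    exact mul_le_mul hnum (inv_anti₀ hηβ hden) (inv_nonneg.2 (Real.rpow_nonneg (mul_nonneg hη.le hadm.1.le) β)) (by positivity)
  -- `(Lᵐη)^β · η^{−β} = (Lᵐ)^β`
  have hratio : ((L : ℝ) ^ m * i.η) ^ β * (i.η ^ β)⁻¹ = ((L : ℝ) ^ m) ^ β := by
    rw [Real.mul_rpow hLm0 hη.le, mul_assoc, mul_inv_cancel₀ hηβ.ne', mul_one]
  have hw2 : 0 ≤ weight L i.η (-(2 : ℝ)) j := B8ScaledSupNorm.weight_nonneg L hη.le _ j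
  calc weight L i.η (-(2 + β)) j * hquot i.η β len U₀ (covDerivFwd i.η U₀ ν fun z => G z κ) (x, x')
      ≤ (weight L i.η (-(2 : ℝ)) j * ((L : ℝ) ^ m * i.η) ^ β) * ((‖F (ν, κ, x')‖ + ‖F (ν, κ, x)‖) * (i.η ^ β)⁻¹) := by
        rw [hwsplit]
        exact mul_le_mul (mul_le_mul_of_nonneg_left hwβ hw2) hquo hq0 (mul_nonneg hw2 (Real.rpow_nonneg (hs0.le.trans hsm) β))
    _ = (((L : ℝ) ^ m * i.η) ^ β * (i.η ^ β)⁻¹) *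
          (weight L i.η (-(2 : ℝ)) j * ‖F (ν, κ, x')‖ + weight L i.η (-(2 : ℝ)) j * ‖F (ν, κ, x)‖) := by ring
    _ ≤ ((L : ℝ) ^ m) ^ β * (B₀ * NJ + B₀ * NJ) := by
        rw [hratio]
        exact mul_le_mul_of_nonneg_left (add_le_add (hpt j hj ν κ x' hx') (hpt j hj ν κ x hx)) (Real.rpow_nonneg hLm0 β)
    _ = 2 * B₀ * (((L : ℝ) ^ m) ^ β) * NJ := by ring

end Holder

/-! ## §2  The N05 head's five N06 binders with ONE constant set for ALL members at a fixed period — NO `η`-law -/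

section Uniform

variable {θ : Stage3Params} [FiniteDimensional ℝ θ.𝔸] (τ : θ.𝔸 →ₗ[ℂ] ℂ) (hτp : ∀ x : θ.𝔸, x ≠ 0 → 0 < (τ (star x * x)).re)
  (hτt : ∀ x y : θ.𝔸, τ (x * y) = τ (y * x)) (hτs : ∀ x : θ.𝔸, τ (star x) = starRingEnd ℂ (τ x)) {P Mκ Rκ : ℕ} [NeZero P]

include hτp hτt hτs in
/-- ★★★★★★ **THE N05 HEAD's FIVE N06 BINDERS WITH ONE CONSTANT SET FOR ALL MEMBERS OF ITS INDEX AND ALL TRUNCATIONS, AT A FIXED PERIOD — UNCONDITIONALLY** (`2 ≤ D`,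
`0 ≤ β`, integer lengths; NO `η`-law): `∃ aI aT > 0, B₀ > 0, C_β c_S c_Sβ ≥ 0` with, for EVERY `j : IdxB8SubDPerκ θ P Mκ Rκ` and every `m ≤ k`, `InvAtHIPer … aI ∧
GlobAtIPer … aT B₀ ∧ HolderAtIH2Per … aT C_β β len ∧ SrcAtIPer … aT c_S ∧ SrcHolderAtIH2Per … aT c_Sβ β len` for the genuine record
`opsAllZdPer τ θ.L P (towerBondsP θ.L j.Ω (j.Λs ·) ·) ops₀ … M j.toZdIdx m` — dag-n06-b g25's `IdxB8SubDPerκ.binders_uniform_of_eta_law` (p682259) with its `η`-law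
hypothesis `hηk` DISCHARGED.  ROUTE: at a fixed period the pairs `(k, (Ω_l read on the torus)_{l ≤ P})` range over a FINITE type; two members with the same code agree on
`(k, Ω, Λs m↾≤m)` (rigidity) and differ only in the spacing `η` and in unread junk; the per-member `InvAtHIPer ∕ GlobAtIPer` of one representative per code
(`IdxB8SubDPerκ.binders_opsAllZdPer_allLevels`) TRANSFER to every member of the code with the same constants by the `η`-SCALING of the record
(`B9Eq326DeltaAEtaScalingZdPer.invAtHIPer_of_eta_mul ∕ globAtIPer_of_eta_mul`: `Δ_a` homogeneous of degree `−2`, `G_𝔤^per` of degree `+2`, (1.7)∕(1.9) and (3.47)'s weights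
`η`-balanced — print p. 83 «rescale the expressions from T_η to T₁»); the Hölder and source binders are then DERIVED at the member from its transferred `GlobAtIPer` (§1,
`srcAtIPer_of_globAtIPer_of_zero`, `srcHolderAtIH2Per_of_holderAtIH2Per_of_zero`) with constants `2B₀(Lᴾ)^β`, `B₀·2K(Lᴾ)³`, `2B₀(Lᴾ)^β·2K(Lᴾ)³`, `K = max{1, PᵈC_τ∕κ}`;
`min ∕ max` over the finite code type.  Constants per PERIOD `P` (volume-uniformity in `P` NOT claimed).
[cite: Balaban1985BackgroundPropagators, Thm 3.11 p.416, Thm 3.3 p.399, (3.42) p.397, (3.43)–(3.47) p.398, (3.26)–(3.27) p.395; Balaban1985RegularSpaces, Thm 8 + (1.146) p.101, (1.58)–(1.59) p.86, (1.3)–(1.6) p.77, (1.31) p.82, p.77 («T_η, η = L^{−k}»), p.83 («rescale … from T_η to T₁»)] -/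
theorem IdxB8SubDPerκ.binders_uniform (hD2 : 2 ≤ θ.D) {Cτ : ℝ} (hCτ : ∀ x y : θ.𝔸, |(τ (star x * y)).re| ≤ Cτ * ‖x‖ * ‖y‖)
    (ops₀ : ℝ → ZdIdx θ.D θ.L → ℕ → OpsZd θ.D θ.𝔸) (M : ℝ) {β : ℝ} (hβ : 0 ≤ β) {len : Site θ.D → ℝ} (hlen : ∀ v : Site θ.D, 0 < len v → 1 ≤ len v) :
    ∃ aI : ℝ, 0 < aI ∧ ∃ aT : ℝ, 0 < aT ∧ ∃ B₀ : ℝ, 0 < B₀ ∧ ∃ Cβ : ℝ, 0 ≤ Cβ ∧ ∃ cS : ℝ, 0 ≤ cS ∧ ∃ cSβ : ℝ, 0 ≤ cSβ ∧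
      ∀ j : IdxB8SubDPerκ θ P Mκ Rκ, ∀ m, m ≤ j.toZdIdx.k →
        InvAtHIPer P θ.L (opsAllZdPer τ θ.L P (fun k l => towerBondsP θ.L j.toZdIdx.Ω (j.toZdIdx.Λs k) l) ops₀) aI M j.toZdIdx m ∧
        GlobAtIPer P θ.L (opsAllZdPer τ θ.L P (fun k l => towerBondsP θ.L j.toZdIdx.Ω (j.toZdIdx.Λs k) l) ops₀) aT B₀ M j.toZdIdx m ∧
        HolderAtIH2Per P θ.L (opsAllZdPer τ θ.L P (fun k l => towerBondsP θ.L j.toZdIdx.Ω (j.toZdIdx.Λs k) l) ops₀) aT Cβ β len M j.toZdIdx m ∧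
        SrcAtIPer P θ.L (opsAllZdPer τ θ.L P (fun k l => towerBondsP θ.L j.toZdIdx.Ω (j.toZdIdx.Λs k) l) ops₀) aT cS M j.toZdIdx m ∧
        SrcHolderAtIH2Per P θ.L (opsAllZdPer τ θ.L P (fun k l => towerBondsP θ.L j.toZdIdx.Ω (j.toZdIdx.Λs k) l) ops₀) aT cSβ β len M j.toZdIdx m := by
  classical
  have hL2 := θ.two_le_L
  haveI : NeZero θ.L := ⟨by omega⟩
  have hL1 : 1 ≤ θ.L := le_trans (by norm_num) hL2
  have hLr : (1 : ℝ) ≤ θ.L := by exact_mod_cast hL1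
  have hD : 0 < θ.D := lt_of_lt_of_le (by norm_num) hD2
  obtain ⟨κ, hκ, hκle⟩ := exists_norm_sq_le_re_trace τ hτp
  -- the two binders we transfer, at `(j, m)` with constants `v = (aI, aT, B₀)`
  let Bnd : IdxB8SubDPerκ θ P Mκ Rκ → ℕ → ℝ × ℝ × ℝ → Prop := fun j m v =>
    InvAtHIPer P θ.L (opsAllZdPer τ θ.L P (fun k l => towerBondsP θ.L j.toZdIdx.Ω (j.toZdIdx.Λs k) l) ops₀) v.1 M j.toZdIdx m ∧
    GlobAtIPer P θ.L (opsAllZdPer τ θ.L P (fun k l => towerBondsP θ.L j.toZdIdx.Ω (j.toZdIdx.Λs k) l) ops₀) v.2.1 v.2.2 M j.toZdIdx m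
  let Pos : ℝ × ℝ × ℝ → Prop := fun v => 0 < v.1 ∧ 0 < v.2.1 ∧ 0 < v.2.2
  -- the per-member package (FILE E §5), projected to `(Inv, Glob)`
  have pkg : ∀ j : IdxB8SubDPerκ θ P Mκ Rκ, ∃ v : ℝ × ℝ × ℝ, Pos v ∧ ∀ m, m ≤ j.toZdIdx.k → Bnd j m v := by
    intro j
    obtain ⟨aI, haI, aT, haT, B₀, hB₀, Cβ, -, cS, -, cSβ, -, h⟩ :=
      B9Thm33SourceWitnessZdPerNested.IdxB8SubDPerκ.binders_opsAllZdPer_allLevels τ hτp hτt hτs hD2 hCτ j ops₀ M hβ hlen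
    exact ⟨(aI, aT, B₀), ⟨haI, haT, hB₀⟩, fun m hm => ⟨(h m hm).1, (h m hm).2.1⟩⟩
  -- the finite code of a member: depth and the torus readings of the domains
  let C : Type := Fin (P + 1) × (Fin (P + 1) → Set (Fin θ.D → ZMod P))
  let code : IdxB8SubDPerκ θ P Mκ Rκ → C := fun j =>
    (⟨j.toZdIdx.k, Nat.lt_succ_of_le (B9Thm33BindersUniformZdPerNested.IdxB8SubDPerκ.k_le_period j)⟩, fun l => j.toPer.ΩTorus l)
  -- constants per code
  let V : C → ℝ × ℝ × ℝ := fun c => if h : ∃ j, code j = c then Classical.choose (pkg (Classical.choose h)) else (1, 1, 1)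
  have hVpos : ∀ c, Pos (V c) := by
    intro c
    by_cases h : ∃ j, code j = c
    · simp only [V, dif_pos h]
      exact (Classical.choose_spec (pkg (Classical.choose h))).1
    · simp only [V, dif_neg h, Pos]
      norm_num
  have hne : (Finset.univ : Finset C).Nonempty := Finset.univ_nonempty
  -- the global constants
  obtain ⟨B₀, hB₀def⟩ : ∃ B₀ : ℝ, Finset.univ.sup' hne (fun c => (V c).2.2) = B₀ := ⟨_, rfl⟩
  have hB₀ : 0 < B₀ := by
    rw [← hB₀def]
    obtain ⟨c, hc⟩ := hne
    exact lt_of_lt_of_le (hVpos c).2.2 (Finset.le_sup' (fun c => (V c).2.2) (Finset.mem_univ c))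
  obtain ⟨K, hKdef⟩ : ∃ K : ℝ, max 1 (((box (d := θ.D) P).card : ℝ) * Cτ / κ) = K := ⟨_, rfl⟩
  have hK1 : 1 ≤ K := by rw [← hKdef]; exact le_max_left _ _
  have hLP0 : (0 : ℝ) ≤ (θ.L : ℝ) ^ P := by positivity
  have hLPβ : 0 ≤ ((θ.L : ℝ) ^ P) ^ β := Real.rpow_nonneg hLP0 β
  refine ⟨Finset.univ.inf' hne (fun c => (V c).1), (Finset.lt_inf'_iff hne).2 (fun c _ => (hVpos c).1),
    Finset.univ.inf' hne (fun c => (V c).2.1), (Finset.lt_inf'_iff hne).2 (fun c _ => (hVpos c).2.1),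
    B₀, hB₀, 2 * B₀ * (((θ.L : ℝ) ^ P) ^ β), by positivity,
    B₀ * (2 * K * ((θ.L : ℝ) ^ P) ^ 3), by positivity,
    2 * B₀ * (((θ.L : ℝ) ^ P) ^ β) * (2 * K * ((θ.L : ℝ) ^ P) ^ 3), by positivity, fun j m hm => ?_⟩
  -- the representative of `j`'s code
  have hcj : ∃ j', code j' = code j := ⟨j, rfl⟩
  set j' : IdxB8SubDPerκ θ P Mκ Rκ := Classical.choose hcj with hj'
  have hcode : code j' = code j := Classical.choose_spec hcj
  have hV : V (code j) = Classical.choose (pkg j') := by simp only [V, dif_pos hcj]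
  obtain ⟨-, hB⟩ := Classical.choose_spec (pkg j')
  -- the two members agree on `(k, Ω, Λs m↾≤m)`; their spacings are related by `c = η ∕ η′ > 0`
  have hk : j'.toZdIdx.k = j.toZdIdx.k := by
    have := congrArg (fun c : C => (c.1 : ℕ)) hcode
    exact this
  have hT : ∀ l, l ≤ P → j'.toPer.ΩTorus l = j.toPer.ΩTorus l := fun l hl => by
    have := congrArg (fun c : C => c.2 ⟨l, Nat.lt_succ_of_le hl⟩) hcode
    exact this
  have hΩ : j.toZdIdx.Ω = j'.toZdIdx.Ω := (B9Thm33BindersUniformZdPerNested.IdxB8SubDPerκ.Ω_eq_of_code_eq j' j hk hT).symm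
  have hm' : m ≤ j'.toZdIdx.k := hk ▸ hm
  have hΛ : ∀ l, l ≤ m → j.toZdIdx.Λs m l = j'.toZdIdx.Λs m l := by
    intro l hl
    have e1 : j'.toZdIdx.Λs m l = B11Eq7Convention.Lam θ.L j'.toZdIdx.Ω m l := j'.toPer.Λs_eq_lam hm' hl
    have e2 : j.toZdIdx.Λs m l = B11Eq7Convention.Lam θ.L j.toZdIdx.Ω m l := j.toPer.Λs_eq_lam hm hl
    rw [e1, e2, hΩ]
  have h𝔅 : ∀ l, l ≤ m → towerBondsP θ.L j.toZdIdx.Ω (j.toZdIdx.Λs m) l = towerBondsP θ.L j'.toZdIdx.Ω (j'.toZdIdx.Λs m) l := by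
    intro l hl
    rw [hΩ]
    exact B9Thm33BindersUniformZdPerNested.towerBondsP_congr fun l' hl' => hΛ l' (hl'.trans hl)
  have hbox : ∀ l, l ≤ m → ∀ b ∈ towerBondsP θ.L j'.toZdIdx.Ω (j'.toZdIdx.Λs m) l,
      ∀ x, InBox (loK θ.L l b.1) (bondHiK θ.L l b.1 b.2) x → x ∈ j'.toZdIdx.Ω (l - 1) :=
    B9Thm311FlatHolonomyKernelZdPerNested.IdxB8SubDPer.towerBondsP_box j'.toPer m
  obtain ⟨c, hcdef⟩ : ∃ c : ℝ, j.toZdIdx.η / j'.toZdIdx.η = c := ⟨_, rfl⟩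
  have hc : 0 < c := by rw [← hcdef]; exact div_pos j.toZdIdx.hη j'.toZdIdx.hη
  have hη : j.toZdIdx.η = c * j'.toZdIdx.η := by rw [← hcdef, div_mul_cancel₀ _ j'.toZdIdx.hη.ne']
  -- the two binders at the representative with ITS constants, transferred to `j` by the η-scaling, weakened to the global constants
  obtain ⟨g1, g2⟩ := hB m hm'
  have hle1 : Finset.univ.inf' hne (fun c => (V c).1) ≤ (Classical.choose (pkg j')).1 := by
    rw [← hV]; exact Finset.inf'_le _ (Finset.mem_univ _)
  have hle2 : Finset.univ.inf' hne (fun c => (V c).2.1) ≤ (Classical.choose (pkg j')).2.1 := by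
    rw [← hV]; exact Finset.inf'_le _ (Finset.mem_univ _)
  have hle3 : (Classical.choose (pkg j')).2.2 ≤ B₀ := by
    rw [← hV, ← hB₀def]; exact Finset.le_sup' (fun c => (V c).2.2) (Finset.mem_univ _)
  have hinv := invAtHIPer_of_eta_mul τ P ops₀ M (𝔅 := fun k l => towerBondsP θ.L j'.toZdIdx.Ω (j'.toZdIdx.Λs k) l)
    (𝔅' := fun k l => towerBondsP θ.L j.toZdIdx.Ω (j.toZdIdx.Λs k) l) hL2 hc hη hΩ hΛ h𝔅 hbox g1
  have hglob0 := globAtIPer_of_eta_mul τ P ops₀ M (𝔅 := fun k l => towerBondsP θ.L j'.toZdIdx.Ω (j'.toZdIdx.Λs k) l)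
    (𝔅' := fun k l => towerBondsP θ.L j.toZdIdx.Ω (j.toZdIdx.Λs k) l) hL2 hc hη hΩ hΛ h𝔅 hbox g2
  have hglob : GlobAtIPer P θ.L (opsAllZdPer τ θ.L P (fun k l => towerBondsP θ.L j.toZdIdx.Ω (j.toZdIdx.Λs k) l) ops₀)
      (Finset.univ.inf' hne (fun c => (V c).2.1)) B₀ M j.toZdIdx m :=
    B9SupplySockB9P3ZdPer.globAtIPer_anti (ha := hle2) (hB := hle3) (h := hglob0)
  -- the Hölder and source binders at `j` from ITS global block
  have hGper : ∀ (U₀ : Site θ.D → Fin θ.D → θ.𝔸ˣ) (J : Site θ.D → Fin θ.D → θ.𝔸), IsPeriodic P U₀ → J ∈ domSubHPer (d := θ.D) (𝔸 := θ.𝔸) P →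
      IsPeriodic P ((opsAllZdPer τ θ.L P (fun k l => towerBondsP θ.L j.toZdIdx.Ω (j.toZdIdx.Λs k) l) ops₀ M j.toZdIdx m).Gop U₀ J) :=
    fun U₀ J _ _ => (B9Thm33GlobalBlockWitnessZdPerNested.gop_mem_domSubHPer_opsAllZdPer τ (P := P) _ ops₀ M j.toZdIdx m U₀ J).1
  have hhol0 := holderAtIH2Per_of_globAtIPer P θ.L hD2 hL1 hB₀.le hGper hβ hlen hglob
  have hmP : m ≤ P := hm.trans (B9Thm33BindersUniformZdPerNested.IdxB8SubDPerκ.k_le_period j)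
  have hLmP : (θ.L : ℝ) ^ m ≤ (θ.L : ℝ) ^ P := pow_le_pow_right₀ hLr hmP
  have hLm0 : (0 : ℝ) ≤ (θ.L : ℝ) ^ m := by positivity
  have hCβle : 2 * B₀ * (((θ.L : ℝ) ^ m) ^ β) ≤ 2 * B₀ * (((θ.L : ℝ) ^ P) ^ β) :=
    mul_le_mul_of_nonneg_left (Real.rpow_le_rpow hLm0 hLmP hβ) (by positivity)
  have hhol : HolderAtIH2Per P θ.L (opsAllZdPer τ θ.L P (fun k l => towerBondsP θ.L j.toZdIdx.Ω (j.toZdIdx.Λs k) l) ops₀)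
      (Finset.univ.inf' hne (fun c => (V c).2.1)) (2 * B₀ * (((θ.L : ℝ) ^ P) ^ β)) β len M j.toZdIdx m :=
    B9SupplySockB9P3ZdH2Per.holderAtIH2Per_anti (ha := le_rfl) (hC := hCβle) (h := hhol0)
  have hsrc0 := srcAtIPer_of_globAtIPer_of_zero τ θ.L P hτt hτs hτp hCτ hκ hκle hL1 _ ops₀ j.toPer.Ω_zero (j.toPer.dvd_level hm) hB₀.le hglob
  have hK3le : B₀ * (2 * max 1 (((box (d := θ.D) P).card : ℝ) * Cτ / κ) * ((θ.L : ℝ) ^ m) ^ 3) ≤ B₀ * (2 * K * ((θ.L : ℝ) ^ P) ^ 3) := by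
    rw [hKdef]
    have : ((θ.L : ℝ) ^ m) ^ 3 ≤ ((θ.L : ℝ) ^ P) ^ 3 := pow_le_pow_left₀ hLm0 hLmP 3
    have hK0 : 0 ≤ K := le_trans zero_le_one hK1
    exact mul_le_mul_of_nonneg_left (mul_le_mul_of_nonneg_left this (by positivity)) hB₀.le
  have hsrc : SrcAtIPer P θ.L (opsAllZdPer τ θ.L P (fun k l => towerBondsP θ.L j.toZdIdx.Ω (j.toZdIdx.Λs k) l) ops₀)
      (Finset.univ.inf' hne (fun c => (V c).2.1)) (B₀ * (2 * K * ((θ.L : ℝ) ^ P) ^ 3)) M j.toZdIdx m :=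
    B9SupplySockB9P3ZdSrcPer.srcAtIPer_anti (ha := le_rfl) (hc := hK3le) (h := hsrc0)
  have hsrcH0 := srcHolderAtIH2Per_of_holderAtIH2Per_of_zero τ θ.L P hD2 hτt hτs hτp hCτ hκ hκle hL1 _ ops₀ j.toPer.Ω_zero (j.toPer.dvd_level hm)
    (by positivity : 0 ≤ 2 * B₀ * (((θ.L : ℝ) ^ P) ^ β)) hβ hlen hhol
  have hKβle : 2 * B₀ * (((θ.L : ℝ) ^ P) ^ β) * (2 * max 1 (((box (d := θ.D) P).card : ℝ) * Cτ / κ) * ((θ.L : ℝ) ^ m) ^ 3) ≤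
      2 * B₀ * (((θ.L : ℝ) ^ P) ^ β) * (2 * K * ((θ.L : ℝ) ^ P) ^ 3) := by
    rw [hKdef]
    have : ((θ.L : ℝ) ^ m) ^ 3 ≤ ((θ.L : ℝ) ^ P) ^ 3 := pow_le_pow_left₀ hLm0 hLmP 3
    have hK0 : 0 ≤ K := le_trans zero_le_one hK1
    exact mul_le_mul_of_nonneg_left (mul_le_mul_of_nonneg_left this (by positivity)) (by positivity)
  have hsrcH : SrcHolderAtIH2Per P θ.L (opsAllZdPer τ θ.L P (fun k l => towerBondsP θ.L j.toZdIdx.Ω (j.toZdIdx.Λs k) l) ops₀)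
      (Finset.univ.inf' hne (fun c => (V c).2.1)) (2 * B₀ * (((θ.L : ℝ) ^ P) ^ β) * (2 * K * ((θ.L : ℝ) ^ P) ^ 3)) β len M j.toZdIdx m :=
    B9SupplySockB9P3ZdSrcPer.srcHolderAtIH2Per_anti (ha := le_rfl) (hc := hKβle) (h := hsrcH0)
  exact ⟨B9Eq327GreenZdHermPer.invAtHIPer_anti (h := hle1) (hI := hinv), hglob, hhol, hsrc, hsrcH⟩

end Uniform

end Literature.MathematicalPhysics.QuantumFieldTheory.Balaban1983to89.B9Thm33BindersUniformZdPerNestedEta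

end
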